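import Summits.AtomisticToContinuum.Crystallization.Theorems.ShellCensus.Negative.TornIcosahedron

/-!
# Refutation of `GappedShellCensus.ShellCensus` (stmt-AtomisticToContinuum-15929)

`ShellCensus` (route `AtomisticToContinuum/Crystallization/GappedShellCensus`, crux, rank 2) claims:
every twelve-point set `T ⊂ ℝ³` with all norms in `[49/50, 51/50]` and all pairwise distances in
`[49/50, 51/50] ∪ [63/50, ∞)` (a *gapped twelve-shell*) is, after a linear isometry, `1/5`-matched
(`ShellCloseTo (1/5)`) to the fcc pattern, the hcp pattern, or the decahedral-axis pattern
(bicapped pentagonal prism).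

**It is false (refuted-substantive): a fourth gapped shell type exists — the TORN ICOSAHEDRON.**
Take a regular icosahedron (edge/circumradius `1.0515`, `1 %` too long for the `2 %` window) and
tear it open at one vertex: that vertex keeps only two of its five bonds, and two of the five
edges of its link pentagon open as well (five icosahedral edges in total become `≥ 63/50`), while
the remaining `25` bonds relax into `[49/50, 51/50]`.  The relaxed shell has SEVEN five-valent
vertices (complete icosahedral caps: five bonded neighbours forming a bonded pentagon), one
four-valent, three three-valent and one two-valent vertex; it exists with uniform slack
`≈ 0.23 %` of all constraints, and with one cap's five spokes shortened to `≤ 1` (used below)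
still with positive slack.  Witness (`ShellCensusNegative.Tint`, units of `10⁻⁶` (exact integers; every metric fact is
an integer inequality on squared norms / squared distances, certified by `decide`).

Why it is not `1/5`-close to any listed pattern.  An `η`-matching composed with the isometry moves
every point by `≤ η = 1/5`, so it changes every pairwise distance by `≤ 2/5`, and it is injective.
* fcc / hcp: every pattern point has exactly four other pattern points at distance `< √2`
  (integer models `fccInt`/`hcpInt`, `decide`), but the witness has a point with five shell points
  within `1`, and `1 + 2/5 < 1.414 < √2`.
* decahedral axis: only the two poles have five pattern points within `1.426` (the ring points
  have four: pole, prism partner, two ring neighbours; the next distance is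
  `√((23 − 3√5)/8) = 1.42705…`, from `cos 72° = (√5 − 1)/4`), but the witness has (at least) three
  points with five shell points within `51/50`, and `51/50 + 2/5 < 1.426`; three points cannot be
  injected into two poles.

No cheap repair: the torn icosahedron is not a degenerate or unnormalised instance — it is an
interior point of the instance set (positive slack in every hypothesis), `> 2/5` away from all three
patterns in the bottleneck sense, and it is one of a FAMILY (at least nine other tear patterns of
the icosahedron with 24–25 bonds were found feasible at `(1/50, 63/50)`, uniform slack
`0.04–0.4 %`; this one persists down to tolerance `1/50 − 0.0023 ≈ 1.77 %` at gap `63/50`);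
enlarging the census alphabet by these low-symmetry, many-cap shells defeats the route's purpose
(they are not rationable five-fold-axis types), and shrinking the tolerance below their threshold
re-enters the regime the route was designed to leave (the decahedral shell itself needs `≈ 0.7 %`).
barrier-candidate: torn-icosahedron gapped twelve-shells at tolerance ≳ 1.5 % under the Hales gap.

Refuter refuter-rattack-stmt-AtomisticToContinuum-15929-0, 2026-08-16.  Everything except the
deciding theorem lives on the negative-side lane `Theorems/ShellCensus/Negative/`:
`MatchingDegree` (matchings, degree obstruction, fcc/hcp near counts), `DecahedralPoles` (the
decahedral pattern has only two poles), `TornIcosahedron` (the witness `T`, its hypotheses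
`T_card`/`T_norm`/`T_dist`, and the three exclusions); this file only assembles them.
-/

namespace Summit.AtomisticToContinuum.Crystallization.Theses.GappedShellCensus
/-- **Record of the dropped route item `ShellCensus`** = stmt-AtomisticToContinuum-15929 (ledger signature verbatim; NOT a route
item): route GappedShellCensus rev 5 (2026-08-17T00:19Z) dropped the refuted/moot `ShellCensus`. The declaration `Summit.AtomisticToContinuum.Crystallization.Theses.GappedShellCensus.ShellCensus`
therefore no longer exists in the route file and this accepted module stopped elaborating (stale olean;
buildfix lane 2026-08-19). Re-created here under its original name so the result keeps building; the
statement of every previously accepted declaration in this file is unchanged. -/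
def ShellCensus : Prop :=
  ∀ T : Finset (EuclideanSpace ℝ (Fin 3)), T.card = 12 → (∀ v ∈ T, 1 - 1 / 50 ≤ ‖v‖ ∧ ‖v‖ ≤ 1 + 1 / 50) → (∀ v ∈ T, ∀ w ∈ T, v ≠ w → 1 - 1 / 50 ≤ dist v w ∧ (dist v w ≤ 1 + 1 / 50 ∨ 63 / 50 ≤ dist v w)) → Literature.Geometry.DiscreteGeometry.ShellCloseTo (1 / 5) T Literature.Geometry.DiscreteGeometry.fccKissingPattern ∨ Literature.Geometry.DiscreteGeometry.ShellCloseTo (1 / 5) T Literature.Geometry.DiscreteGeometry.hcpKissingPattern ∨ Literature.Geometry.DiscreteGeometry.ShellCloseTo (1 / 5) T ((Finset.univ.image fun k : Fin 5 => !₂[Real.sqrt 3 / 2 * Real.cos (2 * Real.pi * k / 5), Real.sqrt 3 / 2 * Real.sin (2 * Real.pi * k / 5), (1 : ℝ) / 2]) ∪ (Finset.univ.image fun k : Fin 5 => !₂[Real.sqrt 3 / 2 * Real.cos (2 * Real.pi * k / 5), Real.sqrt 3 / 2 * Real.sin (2 * Real.pi * k / 5), -(1 : ℝ) / 2]) ∪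 {!₂[(0 : ℝ), 0, 1], !₂[(0 : ℝ), 0, -1]})
end Summit.AtomisticToContinuum.Crystallization.Theses.GappedShellCensus


noncomputable section

namespace Summit.AtomisticToContinuum.Crystallization.Theorems

open Summit.AtomisticToContinuum.Crystallization.Theorems.ShellCensusNegative

/-- Refutes `GappedShellCensus.ShellCensus` (stmt-AtomisticToContinuum-15929) [refuted-substantive]:
the torn-icosahedron shell `ShellCensusNegative.T` (twelve points, integer model
`ShellCensusNegative.Tint` in units of `10⁻⁶`) is a gapped twelve-shell at `(1/50, 63/50)` —
norms and the 25 bonds in `[49/50, 51/50]`, the other 41 pairs `≥ 63/50` — with seven five-valent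
vertices; a `1/5`-matching after an isometry changes distances by `≤ 2/5` and is injective, but
fcc/hcp points have only four pattern points within `√2 > 1 + 2/5` and only the two decahedral
poles have five pattern points within `1.426 > 51/50 + 2/5`, so none of the three disjuncts holds.
Witness: icosahedron torn open at one vertex (five edges opened to `≥ 1.26`, the rest relaxed into
the `2 %` window). No cheap repair: interior point of the instance set, member of a family of torn
shells; the census alphabet {fcc, hcp, dec} is incomplete at tolerance `1/50`.
barrier-candidate: torn-icosahedron gapped twelve-shells at tolerance ≳ 1.5 %. [folklore] -/
theorem GappedShellCensusShellCensus_refuted :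
    ¬ Summit.AtomisticToContinuum.Crystallization.Theses.GappedShellCensus.ShellCensus := by
  intro h
  rcases h T T_card T_norm T_dist with hf | hh | hd
  · exact not_close_fcc hf
  · exact not_close_hcp hh
  · exact not_close_dec hd

end Summit.AtomisticToContinuum.Crystallization.Theorems

end
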